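import Summits.CriticalPhenomena.CardyFormulaZ2.Theorems.CardyMagicRigidityNestingRigidityNeckZ2GatedFourArm
import HarnessLib

/-!
# Crux `NestingRigidity`, line `pinch-resampling` (v4), stub S12: the gated four-arm bound at bigness threshold `0` is Garban's bound

Crux `Summit.CriticalPhenomena.CardyFormulaZ2.Theses.CardyMagicRigidity.NestingRigidity`
(stmt-CriticalPhenomena-4835), line `pinch-resampling` v4, stub S12 `stub_neckHookupCoarseZ2 : NeckHookupCoarseZ2`.
Sanity slice of the named `𝔅`-input `ZGatedFourArmBound` of `…NeckZ2GatedFourArm` (worker W6b, wave 6): with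
bigness threshold `lam = 0` no blob is small, so a gate family is empty and the gated event IS the tree's honest
cluster-form four-arm event; hence the `lam = 0` slice of `ZGatedFourArmBound` holds with the constants of
`QuadCrossing.fourArm_bound` (Garban's multi-scale lemma, proved in the tree) — the named statement extends a theorem
of the tree in the one parameter `lam`.

* `NeckCoarseZ2.zGatedFourArm_zero_subset` — `ZGatedFourArm 0 s x w r R ⊆ fourArmTwoClustersAt w r R`
  (`w` on the inner layer, `1 ≤ r ≤ R ≤ s - 1`);
* `zGatedFourArmBound_zero` (registered anchor) — `∃ C ε > 0, P_{1/2}(ZGatedFourArm 0 s x w r R) ≤ C (r/R)^{1+ε}`.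
-/

noncomputable section

namespace Summit.CriticalPhenomena.CardyFormulaZ2.Cruxes.NestingRigidity.PinchResampling

open MeasureTheory Set Literature.Probability.Percolation Literature.Probability.LatticeModels
open ZPinchLocality
open NeckCoarseZ2

/-- **No gates at threshold `0`**: the gated four-arm event with bigness threshold `0` is contained in the honest
cluster-form four-arm event (every blob of an inner-layer vertex contains that vertex, at sup distance `0 ≥ 0` of
itself, so no gate is small; the avoiding set is then the whole big ball, which contains the annulus). -/
theorem NeckCoarseZ2.zGatedFourArm_zero_subset {s : ℕ} {x w : Site 2} {r R : ℕ}
    (hw : w ∈ innerLayer (zdGraph 2) (zBall x s) (zBall x (2 * s))) (hr : 1 ≤ r) (hrR : r ≤ R) (hRs : R + 1 ≤ s) :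
    ZGatedFourArm 0 s x w r R ⊆ fourArmTwoClustersAt w r R := by
  rintro ω ⟨F, hF, p₁, q₁, p₂, q₂, hp₁, hq₁, hp₂, hq₂, h₁, h₂, hn⟩
  -- the annulus avoids every gate blob: there is no small blob at threshold `0`
  have hAnn : zAnn w r R ⊆ zAvoid s x ω ↑F := by
    intro z hz
    refine ⟨zAnn_subset_zBall hw hRs hz, fun hz' ↦ ?_⟩
    simp only [mem_iUnion, Finset.mem_coe, exists_prop] at hz'
    obtain ⟨c, hc, hzc⟩ := hz'
    exact (hF c hc).2 ⟨z, hzc, z, hzc, by simp [zNorm]⟩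
  exact mem_fourArmTwoClustersAt_of_crossings hr hrR hp₁ hq₁ hp₂ hq₂ (h₁.mono inter_subset_left)
    (h₂.mono inter_subset_left) fun h ↦ hn (h.mono fun z hz ↦ ⟨hz, hAnn hz⟩)

/-- **The `lam = 0` slice of `ZGatedFourArmBound` holds (registered helper, anchor of this module on the crux item)**:
with the constants `C, ε > 0` of `QuadCrossing.fourArm_bound`, for every centre `x`, inner-layer centre `w` and radii
`1 ≤ r ≤ R`, `R + 1 ≤ s`, `P_{1/2}(ZGatedFourArm 0 s x w r R) ≤ C (r/R)^{1+ε}` (no gates, translation invariance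
`real_fourArmTwoClustersAt`, Garban's bound). -/
theorem zGatedFourArmBound_zero : ∃ C ε : ℝ, 0 < C ∧ 0 < ε ∧ ∀ (x w : Site 2) (s r R : ℕ), w ∈ innerLayer (zdGraph 2) (zBall x s) (zBall x (2 * s)) → 1 ≤ r → r ≤ R → R + 1 ≤ s → (bondPercolation (zdGraph 2) half).real (ZGatedFourArm 0 s x w r R) ≤ C * ((r : ℝ) / R) ^ (1 + ε) := by
  obtain ⟨c, ε, hc, hε, h4⟩ := QuadCrossing.fourArm_bound
  refine ⟨c, ε, hc, hε, fun x w s r R hw hr hrR hRs ↦ ?_⟩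
  calc (bondPercolation (zdGraph 2) half).real (ZGatedFourArm 0 s x w r R)
      ≤ (bondPercolation (zdGraph 2) half).real (fourArmTwoClustersAt w r R) :=
        measureReal_mono (NeckCoarseZ2.zGatedFourArm_zero_subset hw hr hrR hRs) (measure_ne_top _ _)
    _ = (bondPercolation (zdGraph 2) half).real (fourArmTwoClusters r R) := real_fourArmTwoClustersAt half w r R
    _ ≤ c * ((r : ℝ) / R) ^ (1 + ε) := h4 r R hr hrR

end Summit.CriticalPhenomena.CardyFormulaZ2.Cruxes.NestingRigidity.PinchResampling

end
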